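import Summits.KontsevichZagierPeriods.KontsevichZagierPeriods.Theses.CoactionDevissage
import Summits.KontsevichZagierPeriods.KontsevichZagierPeriods.Theses.MellinExponentDeformation
import Summits.KontsevichZagierPeriods.KontsevichZagierPeriods.Theses.BianchiHumbert
import Summits.KontsevichZagierPeriods.KontsevichZagierPeriods.Theses.CobordismMove
import Summits.KontsevichZagierPeriods.KontsevichZagierPeriods.Theses.ExceptionalCouplings
import Summits.KontsevichZagierPeriods.KontsevichZagierPeriods.Theses.GenusOneIterated
import Summits.KontsevichZagierPeriods.KontsevichZagierPeriods.Theses.VeryGoodTransfer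
import Summits.KontsevichZagierPeriods.KontsevichZagierPeriods.Theses.EulerFormChain
import Summits.KontsevichZagierPeriods.KontsevichZagierPeriods.Theses.ExponentCosets
import Summits.KontsevichZagierPeriods.KontsevichZagierPeriods.Theorems.MzvKernelInKZ.Negative.ScalingDivision

/-!
# `TorsionFree` (shared support item stmt-KontsevichZagierPeriods-3169) — the nine verbatim twins

The formal period group `KZ.FormalRep ⧸ KZ.relations` of the Kontsevich–Zagier move calculus is
torsion-free: for `n ≠ 0`, `n • c ∈ KZ.relations → c ∈ KZ.relations`. This is already a tree theorem,
`Summit.KontsevichZagierPeriods.MzvKernelInKZ.Negative.mem_relations_of_nsmul_mem`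
(`Theorems/MzvKernelInKZ/Negative/ScalingDivision.lean`: the scaling endomorphism `KZ.scale (n⁻¹)`
preserves the four move sets, and `c − n • scale (n⁻¹) c` is integrand additivity,
`KZ.IntegralRep.of_constMul_nat_sub_nsmul_mem_relations`); the sibling item `IntegerDivision`
(stmt-3934, routes FurushoPentagon / OctahedralSymmetry) was closed by it in
`Theorems/FurushoPentagonIntegerDivision.lean`. This file does the same bookkeeping for the shared
row stmt-3169, whose statement (hypothesis `n ≠ 0` instead of `0 < n`) is filed verbatim by nine
routes: CoactionDevissage, MellinExponentDeformation, BianchiHumbert, CobordismMove,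
ExceptionalCouplings, GenusOneIterated, VeryGoodTransfer, EulerFormChain, ExponentCosets.

No new mathematics; one three-line proof per twin.
-/

namespace Summit.KontsevichZagierPeriods.CoactionDevissage.TorsionFree

open Literature.NumberTheory.Transcendental

/-- The common body of the nine twins: `n ≠ 0 → n • c ∈ KZ.relations → c ∈ KZ.relations`,
from `MzvKernelInKZ.Negative.mem_relations_of_nsmul_mem`. [folklore] -/
theorem mem_relations_of_ne_zero_of_nsmul_mem (n : ℕ) (c : KZ.FormalRep) (hn : n ≠ 0)
    (h : n • c ∈ KZ.relations) : c ∈ KZ.relations :=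
  Summit.KontsevichZagierPeriods.MzvKernelInKZ.Negative.mem_relations_of_nsmul_mem
    (Nat.pos_of_ne_zero hn) h

/-- Route `CoactionDevissage`, item stmt-KontsevichZagierPeriods-3169: `P_KZ` is torsion-free. [folklore] -/
theorem torsionFree_proof :
    Summit.KontsevichZagierPeriods.KontsevichZagierPeriods.Theses.CoactionDevissage.TorsionFree := by
  unfold Summit.KontsevichZagierPeriods.KontsevichZagierPeriods.Theses.CoactionDevissage.TorsionFree
  exact mem_relations_of_ne_zero_of_nsmul_mem

/-- Route `MellinExponentDeformation`, verbatim twin of stmt-KontsevichZagierPeriods-3169. [folklore] -/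
theorem mellinExponentDeformation_torsionFree_proof :
    Summit.KontsevichZagierPeriods.KontsevichZagierPeriods.Theses.MellinExponentDeformation.TorsionFree := by
  unfold Summit.KontsevichZagierPeriods.KontsevichZagierPeriods.Theses.MellinExponentDeformation.TorsionFree
  exact mem_relations_of_ne_zero_of_nsmul_mem

/-- Route `BianchiHumbert`, verbatim twin of stmt-KontsevichZagierPeriods-3169. [folklore] -/
theorem bianchiHumbert_torsionFree_proof :
    Summit.KontsevichZagierPeriods.KontsevichZagierPeriods.Theses.BianchiHumbert.TorsionFree := by
  unfold Summit.KontsevichZagierPeriods.KontsevichZagierPeriods.Theses.BianchiHumbert.TorsionFree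
  exact mem_relations_of_ne_zero_of_nsmul_mem

/-- Route `CobordismMove`, verbatim twin of stmt-KontsevichZagierPeriods-3169. [folklore] -/
theorem cobordismMove_torsionFree_proof :
    Summit.KontsevichZagierPeriods.KontsevichZagierPeriods.Theses.CobordismMove.TorsionFree := by
  unfold Summit.KontsevichZagierPeriods.KontsevichZagierPeriods.Theses.CobordismMove.TorsionFree
  exact mem_relations_of_ne_zero_of_nsmul_mem

/-- Route `ExceptionalCouplings`, verbatim twin of stmt-KontsevichZagierPeriods-3169. [folklore] -/
theorem exceptionalCouplings_torsionFree_proof :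
    Summit.KontsevichZagierPeriods.KontsevichZagierPeriods.Theses.ExceptionalCouplings.TorsionFree := by
  unfold Summit.KontsevichZagierPeriods.KontsevichZagierPeriods.Theses.ExceptionalCouplings.TorsionFree
  exact mem_relations_of_ne_zero_of_nsmul_mem

/-- Route `GenusOneIterated`, verbatim twin of stmt-KontsevichZagierPeriods-3169. [folklore] -/
theorem genusOneIterated_torsionFree_proof :
    Summit.KontsevichZagierPeriods.KontsevichZagierPeriods.Theses.GenusOneIterated.TorsionFree := by
  unfold Summit.KontsevichZagierPeriods.KontsevichZagierPeriods.Theses.GenusOneIterated.TorsionFree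
  exact mem_relations_of_ne_zero_of_nsmul_mem

/-- Route `VeryGoodTransfer`, verbatim twin of stmt-KontsevichZagierPeriods-3169. [folklore] -/
theorem veryGoodTransfer_torsionFree_proof :
    Summit.KontsevichZagierPeriods.KontsevichZagierPeriods.Theses.VeryGoodTransfer.TorsionFree := by
  unfold Summit.KontsevichZagierPeriods.KontsevichZagierPeriods.Theses.VeryGoodTransfer.TorsionFree
  exact mem_relations_of_ne_zero_of_nsmul_mem

/-- Route `EulerFormChain`, verbatim twin of stmt-KontsevichZagierPeriods-3169. [folklore] -/
theorem eulerFormChain_torsionFree_proof :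
    Summit.KontsevichZagierPeriods.KontsevichZagierPeriods.Theses.EulerFormChain.TorsionFree := by
  unfold Summit.KontsevichZagierPeriods.KontsevichZagierPeriods.Theses.EulerFormChain.TorsionFree
  exact mem_relations_of_ne_zero_of_nsmul_mem

/-- Route `ExponentCosets`, verbatim twin of stmt-KontsevichZagierPeriods-3169. [folklore] -/
theorem exponentCosets_torsionFree_proof :
    Summit.KontsevichZagierPeriods.KontsevichZagierPeriods.Theses.ExponentCosets.TorsionFree := by
  unfold Summit.KontsevichZagierPeriods.KontsevichZagierPeriods.Theses.ExponentCosets.TorsionFree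
  exact mem_relations_of_ne_zero_of_nsmul_mem

end Summit.KontsevichZagierPeriods.CoactionDevissage.TorsionFree
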